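import Mathlib
import Summits.ValiantsHypothesis.ValiantsHypothesis.Theorems.DivisionGapZeroOneTransferFaceIsolationDefs

/-!
# Crux `DivisionGap.ZeroOneTransfer` (stmt-ValiantsHypothesis-5066), line `charged-uncharged`, Part E (lead c13) —
stub `stub_brickZone_unique` (E3, A BRICK ZONE IS FROZEN)

Inside the square-lattice part `G0sq m b` of the rung-E-I edge predicate (square edges with both ends
in the same zone, or dominoes of the explicit tiling `u₀`), the only domino tiling of the `n × n`
square is `u₀` itself, granted that `u₀` restricted to the zone is the brick-partner map `brick`.
Proof: a cell off the zones has a single `G0sq`-edge, its `u₀`-domino.  Inside the zones we show by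
strong induction on the column `j` that every LEFT brick cell `(i, j)` is matched with its right
neighbour `(i, j + 1)`: its other possible `G0sq`-neighbours are `u₀ (i, j) = (i, j + 1)` again,
`(i, j - 1)` (if in the zone, the RIGHT cell of the brick `[j - 2, j - 1]` of row `i`) and `(i ± 1, j)`
(if in the same zone, RIGHT cells of the bricks `[j - 1, j]` of the adjacent rows, which have the
opposite brick parity); by the induction hypothesis the left cells of those bricks (columns
`j - 2, j - 1 < j`) are already matched with them, so the involution `f` cannot send them to `(i, j)`.
Right cells are then matched with their left cells because `f` is an involution, and this is `u₀`.
The arithmetic of the zone (`wide`, `inZoneNat`, `zoneLeft`) is unfolded once to linear arithmetic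
with parities (`BrickZoneUnique.inZoneNat_iff`, `BrickZoneUnique.zoneLeft_iff`) and discharged by
`omega`. [folklore]
-/

noncomputable section

set_option linter.dupNamespace false

namespace Summit.ValiantsHypothesis.ValiantsHypothesis.Theorems.DivisionGapZeroOneTransfer

open MvPolynomial
open Literature.Computability.AlgebraicComplexity
open Summit.ValiantsHypothesis.ValiantsHypothesis.Theorems.TriangularDimersDivisionEasy.Negative
open FaceIsolation
open scoped NNReal BigOperators

namespace BrickZoneUnique

/-- Wide rows, unfolded: `i < m` odd or `m ≤ i` even. [folklore] -/
theorem wide_iff (m i : ℕ) : wide m i = true ↔ (i < m ∧ i % 2 = 1 ∨ m ≤ i ∧ i % 2 = 0) := by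
  simp [wide]

/-- Left brick cells, unfolded: odd column in wide rows, even column in narrow rows. [folklore] -/
theorem zoneLeft_iff (m i j : ℕ) :
    zoneLeft m (i, j) = true ↔ (j % 2 = 1 ↔ (i < m ∧ i % 2 = 1 ∨ m ≤ i ∧ i % 2 = 0)) := by
  rw [← wide_iff]
  unfold zoneLeft
  cases wide m i <;> simp

/-- Right brick cells, unfolded. [folklore] -/
theorem zoneLeft_eq_false_iff (m i j : ℕ) :
    zoneLeft m (i, j) = false ↔ ¬ (j % 2 = 1 ↔ (i < m ∧ i % 2 = 1 ∨ m ≤ i ∧ i % 2 = 0)) := by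
  rw [← zoneLeft_iff]
  simp

/-- Zone membership, unfolded: rows `< 2m`, columns `[b-1, b+m]` in wide rows and `[b, b+m-1]` in
narrow rows. [folklore] -/
theorem inZoneNat_iff (m b i j : ℕ) : inZoneNat m b (i, j) ↔
    i < 2 * m ∧ ((i < m ∧ i % 2 = 1 ∨ m ≤ i ∧ i % 2 = 0) → b - 1 ≤ j ∧ j ≤ b + m) ∧
      (¬ (i < m ∧ i % 2 = 1 ∨ m ≤ i ∧ i % 2 = 0) → b ≤ j ∧ j + 1 ≤ b + m) := by
  rw [← wide_iff]
  unfold inZoneNat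
  cases wide m i <;> simp

/-- The left cell of the brick of a RIGHT zone cell `(i, j)` is `(i, j - 1)`: it lies in the zone (the
leftmost cell of every zone row is a left cell, as `b` is even) and is a left cell. [folklore] -/
theorem right_pred {m b i j : ℕ} (hb : Even b) (h2b : 2 ≤ b) (hz : inZoneNat m b (i, j))
    (hr : zoneLeft m (i, j) = false) :
    1 ≤ j ∧ inZoneNat m b (i, j - 1) ∧ zoneLeft m (i, j - 1) = true := by
  rw [inZoneNat_iff] at hz ⊢
  rw [zoneLeft_eq_false_iff] at hr
  rw [zoneLeft_iff]
  obtain ⟨b', rfl⟩ := hb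
  omega

end BrickZoneUnique

open BrickZoneUnique in
/-- **Stub E3 — A BRICK ZONE IS FROZEN.**  Inside the square-lattice part `G0sq` of the rung's edge
predicate (square edges with both ends in the same zone, or dominoes of `u₀`), the only domino tiling is
`u₀`: cells off the zones have a single `G0sq`-edge, and inside a zone the bricks are forced column by
column (the cell below/above the left cell of a brick is the RIGHT cell of its own brick, and so is the
cell to its left). [folklore] -/
theorem stub_brickZone_unique : ∀ (n m b : ℕ), Even m → Even b → m + 2 ≤ b → b + 2 * m + 2 ≤ n →
    (∀ v : Vtx n, InZone m b v → ((u0 m b v).1 : ℕ) = (brick m ((v.1 : ℕ), (v.2 : ℕ))).1 ∧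
        ((u0 m b v).2 : ℕ) = (brick m ((v.1 : ℕ), (v.2 : ℕ))).2) →
    ∀ f : Vtx n → Vtx n, IsSqDimer f → (∀ v, G0sq m b v (f v)) → f = u0 m b := by
  intro n m b _hm hb hmb _hn hu0 f hf hG
  have h2b : 2 ≤ b := le_trans (Nat.le_add_left 2 m) hmb
  -- the brick partner of a left / right zone cell, in coordinates
  have hbrickL : ∀ v : Vtx n, InZone m b v → zoneLeft m ((v.1 : ℕ), (v.2 : ℕ)) = true →
      ((u0 m b v).1 : ℕ) = v.1 ∧ ((u0 m b v).2 : ℕ) = (v.2 : ℕ) + 1 := by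
    intro v hz hl
    simpa [brick, hl] using hu0 v hz
  have hbrickR : ∀ v : Vtx n, InZone m b v → zoneLeft m ((v.1 : ℕ), (v.2 : ℕ)) = false →
      ((u0 m b v).1 : ℕ) = v.1 ∧ ((u0 m b v).2 : ℕ) = (v.2 : ℕ) - 1 := by
    intro v hz hl
    simpa [brick, hl] using hu0 v hz
  -- two cells with the same image under the involution `f` coincide
  have hinj : ∀ v w : Vtx n, f v = f w → v = w := fun v w h => by
    rw [← (hf v).1, ← (hf w).1, h]
  -- KEY CLAIM: every left brick cell is matched with its right neighbour (strong induction on `j`)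
  have key : ∀ j : ℕ, ∀ v : Vtx n, (v.2 : ℕ) = j → InZone m b v →
      zoneLeft m ((v.1 : ℕ), (v.2 : ℕ)) = true →
      ((f v).1 : ℕ) = v.1 ∧ ((f v).2 : ℕ) = (v.2 : ℕ) + 1 := by
    intro j
    induction j using Nat.strong_induction_on with
    | _ j ih =>
    intro v hvj hz hl
    rcases hG v with ⟨k, hkv, hkw, hadj⟩ | hu
    · -- a square edge with both ends in zone `k`
      have hzw : InZone m b (f v) := hkw.1
      have hside : ((v.1 : ℕ) < m ↔ ((f v).1 : ℕ) < m) := by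
        have h1 := hkv.2
        have h2 := hkw.2
        split_ifs at h1 h2 <;> omega
      have hzv' := (inZoneNat_iff m b _ _).1 hz
      have hzw' := (inZoneNat_iff m b _ _).1 hzw
      have hl' := (zoneLeft_iff m _ _).1 hl
      -- the common contradiction: if `f v` is a RIGHT cell of the zone in a column `≤ j`, the left
      -- cell `ℓ` of its brick lies in a column `< j` and is matched with `f v` by induction, so
      -- `ℓ = v`, which the coordinates refute
      have hcontra : zoneLeft m (((f v).1 : ℕ), ((f v).2 : ℕ)) = false → ((f v).2 : ℕ) ≤ j →
          ¬ (((f v).1 : ℕ) = v.1 ∧ ((f v).2 : ℕ) - 1 = (v.2 : ℕ)) → False := by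
        intro hwr hle hne
        obtain ⟨hj1, hzl, hll⟩ := right_pred hb h2b hzw hwr
        obtain ⟨ℓ, hl1, hl2⟩ : ∃ ℓ : Vtx n, (ℓ.1 : ℕ) = (f v).1 ∧ (ℓ.2 : ℕ) = ((f v).2 : ℕ) - 1 :=
          ⟨((f v).1, ⟨((f v).2 : ℕ) - 1, lt_of_le_of_lt (Nat.sub_le _ _) (f v).2.2⟩), rfl, rfl⟩
        have hzl' : InZone m b ℓ := by
          unfold InZone
          rw [hl1, hl2]
          exact hzl
        have hll' : zoneLeft m ((ℓ.1 : ℕ), (ℓ.2 : ℕ)) = true := by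
          rw [hl1, hl2]
          exact hll
        have hfl := ih (((f v).2 : ℕ) - 1) (by omega) ℓ hl2 hzl' hll'
        have hfl' : f ℓ = f v := Prod.ext (Fin.ext (by omega)) (Fin.ext (by omega))
        have hlv : ℓ = v := hinj ℓ v hfl'
        rw [hlv] at hl1 hl2
        exact hne ⟨hl1.symm, by omega⟩
      rcases hadj with ⟨h1, h2⟩ | ⟨h1, h2⟩ | ⟨h1, h2⟩ | ⟨h1, h2⟩
      · -- `f v = (i + 1, j)`: a right cell of the adjacent row
        exfalso
        refine hcontra ((zoneLeft_eq_false_iff m _ _).2 (by omega)) (by omega) (by omega)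
      · -- `f v = (i - 1, j)`: a right cell of the adjacent row
        exfalso
        refine hcontra ((zoneLeft_eq_false_iff m _ _).2 (by omega)) (by omega) (by omega)
      · -- `f v = (i, j + 1)`: the brick
        exact ⟨h1.symm, h2.symm⟩
      · -- `f v = (i, j - 1)`: the right cell of the previous brick of row `i`
        exfalso
        refine hcontra ((zoneLeft_eq_false_iff m _ _).2 (by omega)) (by omega) (by omega)
    · -- the `u₀`-domino of `v`
      rw [hu]
      exact hbrickL v hz hl
  -- CONCLUSION
  funext v
  by_cases hz : InZone m b v
  · cases hl : zoneLeft m ((v.1 : ℕ), (v.2 : ℕ))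
    · -- a right cell: its left cell `ℓ` is matched with it, and `u₀ v = ℓ`
      obtain ⟨hj1, hzl, hll⟩ := right_pred hb h2b hz hl
      obtain ⟨ℓ, hl1, hl2⟩ : ∃ ℓ : Vtx n, (ℓ.1 : ℕ) = v.1 ∧ (ℓ.2 : ℕ) = (v.2 : ℕ) - 1 :=
        ⟨(v.1, ⟨(v.2 : ℕ) - 1, lt_of_le_of_lt (Nat.sub_le _ _) v.2.2⟩), rfl, rfl⟩
      have hzl' : InZone m b ℓ := by
        unfold InZone
        rw [hl1, hl2]
        exact hzl
      have hll' : zoneLeft m ((ℓ.1 : ℕ), (ℓ.2 : ℕ)) = true := by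
        rw [hl1, hl2]
        exact hll
      have hfl := key _ ℓ hl2 hzl' hll'
      have hfl' : f ℓ = v := Prod.ext (Fin.ext (by omega)) (Fin.ext (by omega))
      have hfv : f v = ℓ := by rw [← hfl', (hf ℓ).1]
      obtain ⟨e1, e2⟩ := hbrickR v hz hl
      rw [hfv]
      exact Prod.ext (Fin.ext (by omega)) (Fin.ext (by omega))
    · -- a left cell
      obtain ⟨e1, e2⟩ := key _ v rfl hz hl
      obtain ⟨u1, u2⟩ := hbrickL v hz hl
      exact Prod.ext (Fin.ext (by omega)) (Fin.ext (by omega))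
  · -- off the zones only the `u₀`-domino is allowed
    rcases hG v with ⟨k, hk, -, -⟩ | h
    · exact absurd hk.1 hz
    · exact h

end Summit.ValiantsHypothesis.ValiantsHypothesis.Theorems.DivisionGapZeroOneTransfer

end
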